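import Mathlib.RingTheory.QuasiFinite.Basic
import Mathlib.RingTheory.Nullstellensatz
import Literature.AlgebraicGeometry.HodgeTheory.GAGADimensionProofs
import Literature.RingTheory.KrullDimension.AffineDimension
import Literature.Geometry.Kaehler.AnalyticSetFiniteMaps
import Literature.Geometry.Kaehler.AnalyticSetSingularLocusCodim
import HarnessLib

/-!
# GAGA dimension comparison — the converse inequality (analytic codimension ≥ algebraic codimension)

Companion of `HodgeTheory/GAGADimension.lean` / `GAGADimensionProofs.lean`, which vendor and prove
Serre's dimension comparison (*Géométrie algébrique et géométrie analytique*, §6 Prop. 3 Cor. 2–3,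
printed p. 11: «Les anneaux `𝒪_x` et `ℋ_x` ont même dimension»; «Si `X` est une variété algébrique
irréductible de dimension `r`, l'espace analytique `X^h` est de dimension analytique `r` en chacun
de ses points») in ONE direction — `gaga_le_coheight_of_regularLocus_codim_holds`: analytic
codimension `≥ p` everywhere on `φ⁻¹(Z(ℂ))` forces algebraic codimension `≥ p` on `Z` ("what is NOT
here: the converse inequality", loc. cit.). This file PROVES the converse inequality, so that the
tree now has the printed EQUALITY of dimensions for analytifications of smooth projective varieties:

* `le_regularLocus_codim_of_le_coheight` — for `X` smooth projective of dimension `n` over `ℂ`, an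
  analytification `φ : M → X(ℂ)` (`IsAnalytification`, holomorphic atlas on `M`) and a Zariski-closed
  `Z ⊆ X` all of whose scheme points have codimension (`Order.coheight`) `≥ p`, every regular point
  of the analytic set `φ⁻¹(Z(ℂ))` has complex codimension `≥ p`.

Serre derives Cor. 3 from the comparison of completions (Prop. 3) and §1 n°4. The Lean proof is the
classical Noether-normalisation argument for `dim_an ≤ dim_alg` (a finite-fibred holomorphic map to
`ℂ^d` cannot live on a complex submanifold of dimension `> d`):

* `GAGADimension.ringKrullDim_quotient_le_of_le_height` — for an affine domain `A` of dimension `n`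
  over a field and an ideal `I` all of whose primes have height `≥ p`, `dim A/I ≤ n − p`
  (Hartshorne I Thm. 1.8A (b), in the tree as `Motives.Ideal.height_add_ringKrullDim_quotient`);
* `GAGADimension.exists_finite_setOf_isMaximal` — Noether normalisation with FINITE fibres on closed
  points: `s = dim B` elements `y₁, …, y_s` of a finitely generated algebra `B` over an algebraically
  closed field such that only finitely many maximal ideals contain all `yᵢ − cᵢ`, for every value `c`
  (Mathlib's `exists_finite_inj_algHom_of_fg`, the tree's
  `Literature.RingTheory.KrullDimension.ringKrullDim_eq_of_isIntegral`, and Mathlib's quasi-finiteness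
  of finite algebras `Algebra.QuasiFinite.finite_primesOver`; Görtz–Wedhorn I, Cor. 5.17 and
  Lemma 5.14);
* `exists_affineOpen_finite_fibers` — on a standard smooth affine chart `U ∋ z` of `X`, regular
  functions `a₁, …, a_s`, `s + p ≤ n`, whose joint level sets on the complex points of `Z ∩ U` are
  finite (complex points of an affine are determined by evaluation, `AlgPoints.ext_of_forall_eval_eq`);
* `GAGADimension.finrank_le_codim_add_of_finite_fibers` — the analytic half: if a holomorphic
  `Θ : W → ℂˢ` has finite level sets on `S ∩ W` and `m ∈ S ∩ W` is a regular point of `S` of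
  codimension `q`, then `dim E ≤ q + s` (straighten `S` near `m`, `SCV.exists_straightening`; a
  holomorphic map with discrete fibres is immersive somewhere, `SCV.exists_injective_fderiv_of_isolated`,
  Chirka §2.7).

Everything is proved; no named facts. Consumer: GAGA for line bundles
(`HodgeTheory/GAGALineBundles*`: components of the zero divisor of a holomorphic section are
algebraic of codimension ONE, and the bad locus of a divisor is analytically of codimension `≥ 2`).

## References

* J.-P. Serre, *Géométrie algébrique et géométrie analytique*, Ann. Inst. Fourier **6** (1956),
  §6 Prop. 3 Cor. 2–3 (printed p. 11). [SerreGAGA1956]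
* U. Görtz, T. Wedhorn, *Algebraic Geometry I*, 2nd ed. (2020), Cor. 5.17, Lemma 5.14, Thm. 5.15.
  [GortzWedhorn2020]
* R. Hartshorne, *Algebraic Geometry* (1977), I Thm. 1.8A. [Hartshorne1977]
* E. M. Chirka, *Complex Analytic Sets* (1989), §2.7, §3.3 Prop. 1. [Chirka1989]
-/

noncomputable section

open scoped Manifold ContDiff Topology
open CategoryTheory AlgebraicGeometry Filter Set
open Literature.AlgebraicGeometry.Motives
open Literature.AlgebraicGeometry.Motives.AlgPoints (evalOrZero evalOrZero_of_mem evalOrZero_of_not_mem)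
open Literature.NumberTheory.Transcendental

universe u

namespace Literature.AlgebraicGeometry.HodgeTheory

namespace GAGADimension

/-! ### Algebra: quotients by ideals all of whose primes are high have small dimension -/

section Algebra

variable (K : Type u) [Field K]

/-- **`dim A/I ≤ dim A − p` if every prime containing `I` has height `≥ p`** (for an affine domain
`A` of dimension `n` over a field: a chain of primes above `I` starting at `P` has length
`≤ dim A/P = n − ht P`, Hartshorne I Thm. 1.8A (b)). [cite: Hartshorne1977, I Thm. 1.8A (b)] -/
theorem ringKrullDim_quotient_le_of_le_height (A : Type u) [CommRing A] [IsDomain A] [Algebra K A]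
    [Algebra.FiniteType K A] {n : ℕ} (hA : ringKrullDim A = n) (I : Ideal A) {p : ℕ}
    (hI : ∀ P : Ideal A, P.IsPrime → I ≤ P → (p : ℕ∞) ≤ P.height) :
    ringKrullDim (A ⧸ I) ≤ (n - p : ℕ) := by
  rw [ringKrullDim_quotient]
  refine iSup_le fun q ↦ ?_
  -- the chain `q` in `V(I)`, read in `Spec A`, sits above its head `P`
  set P : PrimeSpectrum A := (q.head).1 with hP
  have hIP : I ≤ P.asIdeal := q.head.2
  haveI := P.2
  -- `dim A/P = n - ht P ≤ n - p`
  obtain ⟨d, hd⟩ := exists_ringKrullDim_eq_natCast K (A ⧸ P.asIdeal)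
  obtain ⟨c, hc⟩ : ∃ c : ℕ, P.asIdeal.height = c := by
    have h := Ideal.height_le_ringKrullDim_of_isPrime (I := P.asIdeal)
    rw [hA] at h
    have hne : P.asIdeal.height ≠ ⊤ := by
      intro htop
      rw [htop] at h
      exact (not_le.2 (WithBot.coe_lt_coe.2 (ENat.coe_lt_top n))) h
    obtain ⟨c, hc⟩ := ENat.ne_top_iff_exists.mp hne
    exact ⟨c, hc.symm⟩
  have hcd : c + d = n := by
    have h1 := Ideal.height_add_ringKrullDim_quotient K A P.asIdeal
    rw [hc, hd, hA] at h1
    exact_mod_cast h1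
  have hpc : p ≤ c := by
    have := hI P.asIdeal P.2 hIP
    rw [hc] at this
    exact_mod_cast this
  -- `length q ≤ coheight P = dim A/P`
  set q' : LTSeries (PrimeSpectrum A) := q.map Subtype.val (fun _ _ h ↦ h) with hq'
  have hlen : q.length = q'.length := (LTSeries.map_length q Subtype.val _).symm
  have hhead : q'.head = P := by rw [hq', LTSeries.head_map]
  have h1 : (q'.length : ℕ∞) ≤ Order.coheight q'.head := Order.length_le_coheight_head
  have h2 : (Order.coheight P : WithBot ℕ∞) = ringKrullDim (A ⧸ P.asIdeal) := by
    rw [Order.coheight_eq_krullDim_Ici, ringKrullDim_quotient]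
    refine Order.krullDim_eq_of_orderIso (OrderIso.setCongr _ _ ?_)
    ext Q
    simp [PrimeSpectrum.mem_zeroLocus, ← PrimeSpectrum.asIdeal_le_asIdeal, SetLike.coe_subset_coe]
  rw [hhead] at h1
  have h3 : ((q.length : ℕ∞) : WithBot ℕ∞) ≤ (d : WithBot ℕ∞) := by
    rw [← hd, ← h2, hlen]
    exact_mod_cast h1
  have h4 : d ≤ n - p := by omega
  calc (q.length : WithBot ℕ∞) = ((q.length : ℕ∞) : WithBot ℕ∞) := rfl
    _ ≤ d := h3
    _ ≤ ((n - p : ℕ) : WithBot ℕ∞) := by exact_mod_cast h4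

/-- **Noether normalisation has finite fibres on closed points.** A finitely generated algebra
`B` over the algebraically closed field `K` with `dim B ≤ d` contains `s ≤ d` elements `y₁, …, y_s`
(the images of the variables under a FINITE injective `K[X₁, …, X_s] ↪ B`, Mathlib's Noether
normalisation `exists_finite_inj_algHom_of_fg`, with `s = dim B` by
`Literature.RingTheory.KrullDimension.ringKrullDim_eq_of_isIntegral`) such that for every value
`c : Fin s → K` only finitely many maximal ideals of `B` contain all the `yᵢ − cᵢ` (the maximal
ideals over the maximal ideal `(Xᵢ − cᵢ)` of the polynomial ring: Mathlib
`Algebra.QuasiFinite.finite_primesOver`). [cite: GortzWedhorn2020, Cor. 5.17 and Lemma 5.14] -/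
theorem exists_finite_setOf_isMaximal [IsAlgClosed K] (B : Type u) [CommRing B] [Nontrivial B]
    [Algebra K B] [Algebra.FiniteType K B] {d : ℕ} (hB : ringKrullDim B ≤ d) :
    ∃ s ≤ d, ∃ y : Fin s → B, ∀ c : Fin s → K,
      {𝔪 : Ideal B | 𝔪.IsMaximal ∧ ∀ i, y i - algebraMap K B (c i) ∈ 𝔪}.Finite := by
  classical
  obtain ⟨s, g, hinj, hfin⟩ := exists_finite_inj_algHom_of_fg K B
  letI : Algebra (MvPolynomial (Fin s) K) B := g.toRingHom.toAlgebra
  haveI : Module.Finite (MvPolynomial (Fin s) K) B := hfin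
  haveI : Algebra.IsIntegral (MvPolynomial (Fin s) K) B := Algebra.IsIntegral.of_finite _ _
  have hinj' : Function.Injective (algebraMap (MvPolynomial (Fin s) K) B) := hinj
  have hsdim : ringKrullDim B = s := by
    rw [← Literature.RingTheory.KrullDimension.ringKrullDim_eq_of_isIntegral hinj',
      MvPolynomial.ringKrullDim_of_isNoetherianRing, ringKrullDim_eq_zero_of_field]
    simp
  refine ⟨s, ?_, fun i ↦ g (MvPolynomial.X i), fun c ↦ ?_⟩
  · have : (s : WithBot ℕ∞) ≤ d := by rw [← hsdim]; exact hB
    exact_mod_cast this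
  · set 𝔫 : Ideal (MvPolynomial (Fin s) K) := MvPolynomial.vanishingIdeal K {c} with h𝔫
    refine (Algebra.QuasiFinite.finite_primesOver (R := MvPolynomial (Fin s) K) (S := B) 𝔫).subset ?_
    rintro 𝔪 ⟨h𝔪, hy⟩
    haveI := h𝔪
    refine ⟨h𝔪.isPrime, ⟨?_⟩⟩
    -- the contraction of `𝔪` is a maximal ideal `vanishingIdeal {x}` containing the `Xᵢ - cᵢ`
    have hmax : (𝔪.under (MvPolynomial (Fin s) K)).IsMaximal := inferInstance
    obtain ⟨x, hx⟩ := (MvPolynomial.isMaximal_iff_eq_vanishingIdeal_singleton (K := K)).1 hmax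
    have hxc : x = c := by
      funext i
      have hmem : MvPolynomial.X i - MvPolynomial.C (c i) ∈ 𝔪.under (MvPolynomial (Fin s) K) := by
        rw [Ideal.under, Ideal.mem_comap, RingHom.algebraMap_toAlgebra, AlgHom.toRingHom_eq_coe,
          RingHom.coe_coe, map_sub, ← MvPolynomial.algebraMap_eq, g.commutes (c i)]
        exact hy i
      rw [hx, MvPolynomial.mem_vanishingIdeal_singleton_iff] at hmem
      simpa [sub_eq_zero] using hmem
    rw [h𝔫, ← hxc]
    exact hx.symm

end Algebra

/-! ### Analysis: finite fibres on a submanifold piece bound its dimension -/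

section Analytic

open Literature.Geometry.Kaehler Literature.Geometry.Kaehler.SCV Literature.Analysis.Complex.SCV

variable {E : Type*} [NormedAddCommGroup E] [NormedSpace ℂ E] [FiniteDimensional ℂ E]
  {M : Type*} [TopologicalSpace M] [ChartedSpace E M] [IsManifold 𝓘(ℂ, E) 1 M]

/-- **A holomorphic map with finite fibres on a regular piece of codimension `q` forces
`dim E ≤ q + (number of components)`.** Let `S ⊆ M` (a complex manifold charted on `E`), `W` open,
`Θ : M → ℂˢ` holomorphic on `W` with all level sets `S ∩ W ∩ Θ⁻¹(c)` finite, and `m ∈ S ∩ W` a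
regular point of `S` of codimension `q`. Then `dim E ≤ q + s`: in a chart, `S` is straightened near
`m` to an open piece `O` of `ker dg ≅ ℂ^{dim E − q}` (`exists_straightening`), on which `Θ` is a
holomorphic map with finite, hence discrete, fibres, so it is immersive somewhere
(`SCV.exists_injective_fderiv_of_isolated`, Chirka §2.7), whence `dim E − q ≤ s`.
[cite: Chirka1989, §2.7 and §3.3 Prop. 1] -/
theorem finrank_le_codim_add_of_finite_fibers {S W : Set M} (hW : IsOpen W) {s : ℕ}
    {Θ : M → (Fin s → ℂ)} (hΘ : MDifferentiableOn 𝓘(ℂ, E) 𝓘(ℂ, Fin s → ℂ) Θ W)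
    (hfin : ∀ c, (S ∩ W ∩ Θ ⁻¹' {c}).Finite) {m : M} (hmS : m ∈ S) (hmW : m ∈ W) {q : ℕ}
    (hreg : IsRegularPointOfCodim 𝓘(ℂ, E) S q m) : Module.finrank ℂ E ≤ q + s := by
  set e := extChartAt 𝓘(ℂ, E) m with he
  have hms : m ∈ e.source := mem_extChartAt_source m
  obtain ⟨U₀, hU₀, hxU₀, g, hg, hSU₀, hsurj⟩ := hreg.isRegPt_chartImage hms
  -- `Θ` read in the chart
  have hΘ' : DifferentiableOn ℂ (Θ ∘ e.symm) (e.target ∩ e.symm ⁻¹' W) :=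
    hΘ.differentiableOn_extChartAt_symm m
  have hWo' : IsOpen (e.target ∩ e.symm ⁻¹' W) := isOpen_extChartAt_target_inter_preimage_symm m hW
  -- straighten the defining submersion `g` near `e m`
  obtain ⟨ψ, hbij⟩ := exists_proj_ker_bijective (fderiv ℂ g (e m)) hsurj
  set K := ↥(LinearMap.ker ((fderiv ℂ g (e m) : E →ₗ[ℂ] (Fin q → ℂ)))) with hK
  have hxW₀ : e m ∈ U₀ ∩ (e.target ∩ e.symm ⁻¹' W) :=
    ⟨hxU₀, e.map_source hms, by show e.symm (e m) ∈ W; rwa [e.left_inv hms]⟩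
  obtain ⟨S₀, T, Ψ, hS₀o, hxS₀, hS₀W, hTo, hΨ, hΦΨ, hΨΦ, -⟩ :=
    exists_straightening (hg.mono inter_subset_left) (hU₀.inter hWo') hxW₀ ψ hbij
  have hgx : g (e m) = 0 :=
    (hSU₀.subset ⟨⟨e.map_source hms, by show e.symm (e m) ∈ S; rwa [e.left_inv hms]⟩, hxU₀⟩).2
  -- the parameter space `O ⊆ K` of the straightened piece and the map `G = Θ` on it
  set ι₀ : K → (Fin q → ℂ) × K := fun k ↦ (0, k) with hι₀
  have hι₀c : Continuous ι₀ := continuous_const.prodMk continuous_id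
  have hι₀d : Differentiable ℂ ι₀ := (differentiable_const _).prodMk differentiable_id
  set O : Set K := ι₀ ⁻¹' T with hO_def
  have hO : IsOpen O := hTo.preimage hι₀c
  have h0O : (0 : K) ∈ O := by
    show ((0 : Fin q → ℂ), (0 : K)) ∈ T
    have h := (hΦΨ (e m) hxS₀).1
    rwa [hgx, sub_self, map_zero] at h
  set G : K → (Fin s → ℂ) := fun k ↦ Θ (e.symm (Ψ (ι₀ k))) with hG_def
  have hpiece : ∀ k ∈ O, Ψ (ι₀ k) ∈ e.target ∧ e.symm (Ψ (ι₀ k)) ∈ S ∧ e.symm (Ψ (ι₀ k)) ∈ W := by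
    intro k hk
    have h1 := hΨΦ (ι₀ k) hk
    have hS₀' := hS₀W h1.1
    have hg0 : g (Ψ (ι₀ k)) = 0 := by
      have := congrArg Prod.fst h1.2
      simpa [hι₀] using this
    have hmem : Ψ (ι₀ k) ∈ chartImage 𝓘(ℂ, E) m S := (hSU₀.symm.subset ⟨hS₀'.1, hg0⟩).1
    exact ⟨hS₀'.2.1, hmem.2, hS₀'.2.2⟩
  have hGd : DifferentiableOn ℂ G O :=
    hΘ'.comp (hΨ.comp hι₀d.differentiableOn fun k hk ↦ hk)
      fun k hk ↦ ⟨(hpiece k hk).1, (hpiece k hk).2.2⟩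
  -- `k ↦ e.symm (Ψ (0, k))` is injective on `O`
  have hinjO : InjOn (fun k ↦ e.symm (Ψ (ι₀ k))) O := by
    intro k hk k' hk' hkk'
    have h1 : Ψ (ι₀ k) = Ψ (ι₀ k') :=
      e.symm.injOn (by rw [PartialEquiv.symm_source]; exact (hpiece k hk).1)
        (by rw [PartialEquiv.symm_source]; exact (hpiece k' hk').1) hkk'
    have h2 : ι₀ k = ι₀ k' := by rw [← (hΨΦ _ hk).2, ← (hΨΦ _ hk').2, h1]
    simpa [hι₀] using congrArg Prod.snd h2
  -- the fibres of `G` on `O` are finite, hence discrete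
  have hfib : ∀ k ∈ O, {k' ∈ O | G k' = G k}.Finite := by
    intro k hk
    refine Set.Finite.of_finite_image ((hfin (G k)).subset ?_) (hinjO.mono fun k' hk' ↦ hk'.1)
    rintro _ ⟨k', ⟨hk'O, hk'G⟩, rfl⟩
    exact ⟨⟨(hpiece k' hk'O).2.1, (hpiece k' hk'O).2.2⟩, hk'G⟩
  have hiso : ∀ k ∈ O, ∀ᶠ k' in 𝓝[≠] k, G k' ≠ G k := by
    intro k hk
    have hcl : IsClosed ({k' ∈ O | G k' = G k} \ {k}) := ((hfib k hk).subset sdiff_subset).isClosed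
    have h1 : ∀ᶠ k' in 𝓝 k, k' ∈ O := hO.mem_nhds hk
    have h2 : ∀ᶠ k' in 𝓝 k, k' ∉ {k' ∈ O | G k' = G k} \ {k} :=
      hcl.isOpen_compl.mem_nhds fun h ↦ h.2 rfl
    filter_upwards [eventually_nhdsWithin_of_eventually_nhds (h1.and h2), self_mem_nhdsWithin]
      with k' hk' hne hEq
    exact hk'.2 ⟨⟨hk'.1, hEq⟩, hne⟩
  obtain ⟨u, -, hu⟩ := exists_injective_fderiv_of_isolated hO ⟨0, h0O⟩ hGd hiso
  -- dimension count: `dim K = dim E - q` and `dim K ≤ s`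
  have hKq : Module.finrank ℂ K + q = Module.finrank ℂ E := by
    have h := LinearMap.finrank_range_add_finrank_ker ((fderiv ℂ g (e m) : E →ₗ[ℂ] (Fin q → ℂ)))
    rw [LinearMap.range_eq_top.2 hsurj, finrank_top, Module.finrank_fin_fun] at h
    rw [add_comm]
    exact h
  have hKs : Module.finrank ℂ K ≤ s := by
    have h := LinearMap.finrank_le_finrank_of_injective (f := ((fderiv ℂ G u : K →ₗ[ℂ] (Fin s → ℂ)))) hu
    rwa [Module.finrank_fin_fun] at h
  omega

end Analytic

end GAGADimension

open GAGADimension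

/-! ### Schemes: Noether coordinates on an affine chart with finite fibres on `Z(ℂ)` -/

/-- **Finite fibres of Noether coordinates on the complex points of a closed subset.** Let `X` be
smooth projective of dimension `n` over `ℂ` and `Z ⊆ X` Zariski-closed, all of whose points have
codimension (`Order.coheight`) `≥ p`. Every `z ∈ Z` has an affine open neighbourhood `U` carrying
regular functions `a₁, …, a_s`, `s + p ≤ n`, whose joint level sets on the complex points of
`Z ∩ U` are finite: Noether coordinates of the reduced closed subscheme `Z ∩ U` of dimension
`≤ n − p` (`ringKrullDim_quotient_le_of_le_height`, `exists_finite_setOf_isMaximal`; complex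
points of the affine `U` are determined by their evaluations, `AlgPoints.ext_of_forall_eval_eq`).
[cite: SerreGAGA1956, §6 Prop. 3 Cor. 3 (p. 11)] [cite: GortzWedhorn2020, Cor. 5.17 and Lemma 5.14] -/
theorem exists_affineOpen_finite_fibers ⦃n : ℕ⦄ ⦃X : SchemeOver ℂ⦄ (hX : IsSmoothProjective n X)
    {p : ℕ} {Z : Set X.left} (hZ : IsClosed Z) (hcoh : ∀ z ∈ Z, (p : ℕ∞) ≤ Order.coheight z)
    {z : X.left} (hz : z ∈ Z) :
    ∃ U : X.left.Opens, z ∈ U ∧ ∃ s : ℕ, s + p ≤ n ∧ ∃ a : Fin s → Γ(X.left, U),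
      ∀ c : Fin s → ℂ, {P : ComplexPoints X | ∃ h : P.pt ∈ U, P.pt ∈ Z ∧
        ∀ i, P.eval U h (a i) = c i}.Finite := by
  classical
  haveI : IsIntegral X.left := Motives.IsSmoothProjective.isIntegral_holds hX
  haveI := hX.smoothOfRelativeDimension
  haveI : LocallyOfFiniteType X.hom := by
    haveI : Smooth X.hom := SmoothOfRelativeDimension.smooth n _
    infer_instance
  -- a standard smooth affine chart `U = Spec A ∋ z`
  obtain ⟨U, hU, hzU, hsm⟩ := exists_isStandardSmoothOfRelativeDimension_scalarRingHom' X n z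
  letI : Algebra ℂ Γ(X.left, U) := (SchemeOver.scalarRingHom X U).toAlgebra
  haveI : Algebra.IsStandardSmoothOfRelativeDimension n ℂ Γ(X.left, U) := hsm
  haveI : Nonempty U := ⟨⟨z, hzU⟩⟩
  haveI : IsDomain Γ(X.left, U) := IsIntegral.component_integral U
  haveI : Algebra.IsStandardSmooth ℂ Γ(X.left, U) :=
    Algebra.IsStandardSmoothOfRelativeDimension.isStandardSmooth n
  haveI : Algebra.FiniteType ℂ Γ(X.left, U) := inferInstance
  haveI : IsNoetherianRing Γ(X.left, U) := Algebra.FiniteType.isNoetherianRing ℂ _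
  have hdimA : ringKrullDim Γ(X.left, U) = n :=
    Motives.ringKrullDim_eq_of_isStandardSmoothOfRelativeDimension ℂ n
  -- the ideal of `Z ∩ U`
  set Z' : Set (Spec Γ(X.left, U)) := hU.fromSpec.base ⁻¹' Z with hZ'def
  have hZ'cl : IsClosed Z' := hZ.preimage hU.fromSpec.base.hom.continuous
  set I : Ideal Γ(X.left, U) := PrimeSpectrum.vanishingIdeal Z' with hIdef
  have hZI : ∀ q : Spec Γ(X.left, U), q ∈ Z' ↔ I ≤ q.asIdeal := fun q ↦ by
    have h1 : PrimeSpectrum.zeroLocus (I : Set Γ(X.left, U)) = Z' := by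
      rw [hIdef, PrimeSpectrum.zeroLocus_vanishingIdeal_eq_closure]
      exact hZ'cl.closure_eq
    rw [← h1]
    rfl
  -- every prime above `I` is a point of `Z`, of height `≥ p`
  have hIht : ∀ P : Ideal Γ(X.left, U), P.IsPrime → I ≤ P → (p : ℕ∞) ≤ P.height := by
    intro P hP hIP
    let y : Spec Γ(X.left, U) := ⟨P, hP⟩
    have hyZ : hU.fromSpec.base y ∈ Z := (hZI y).2 hIP
    calc (p : ℕ∞) ≤ Order.coheight (hU.fromSpec.base y) := hcoh _ hyZ
      _ = Order.coheight y := coheight_eq_of_isOpenImmersion hU.fromSpec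
      _ = P.height := (idealHeight_eq_coheight _ y).symm
  -- `I ≠ ⊤` (the prime of `z` lies above it) and `p ≤ n`
  set qz : Spec Γ(X.left, U) := hU.primeIdealOf ⟨z, hzU⟩ with hqzdef
  have hqz : hU.fromSpec.base qz = z := hU.fromSpec_primeIdealOf ⟨z, hzU⟩
  have hIqz : I ≤ qz.asIdeal := (hZI qz).1 (show hU.fromSpec.base qz ∈ Z by rw [hqz]; exact hz)
  have hItop : I ≠ ⊤ := fun h ↦ qz.2.ne_top (top_le_iff.1 (h ▸ hIqz))
  have hpn : p ≤ n := by
    have h1 := hIht qz.asIdeal qz.2 hIqz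
    have h2 := Ideal.height_le_ringKrullDim_of_isPrime (I := qz.asIdeal)
    rw [hdimA] at h2
    have h3 : ((p : ℕ∞) : WithBot ℕ∞) ≤ n := (WithBot.coe_le_coe.2 h1).trans h2
    exact_mod_cast h3
  -- Noether coordinates of `B = A/I`, `dim B ≤ n - p`
  haveI : Nontrivial (Γ(X.left, U) ⧸ I) := Ideal.Quotient.nontrivial_iff.2 hItop
  haveI : Algebra.FiniteType ℂ (Γ(X.left, U) ⧸ I) :=
    (inferInstance : Algebra.FiniteType ℂ Γ(X.left, U)).of_surjective (Ideal.Quotient.mkₐ ℂ I)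
      (Ideal.Quotient.mkₐ_surjective ℂ I)
  have hdimB : ringKrullDim (Γ(X.left, U) ⧸ I) ≤ (n - p : ℕ) :=
    ringKrullDim_quotient_le_of_le_height ℂ Γ(X.left, U) hdimA I hIht
  obtain ⟨s, hs, y, hy⟩ := exists_finite_setOf_isMaximal ℂ (Γ(X.left, U) ⧸ I) hdimB
  choose a ha using fun i ↦ Ideal.Quotient.mk_surjective (y i)
  refine ⟨U, hzU, s, by omega, a, fun c ↦ ?_⟩
  -- evaluation at a complex point of `U`: kernel, values
  have hevalmem : ∀ (Q : ComplexPoints X) (hQ : Q.pt ∈ U) (f : Γ(X.left, U)),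
      Q.eval U hQ f = 0 ↔ f ∈ (hU.primeIdealOf ⟨Q.pt, hQ⟩).asIdeal := fun Q hQ f ↦
    not_iff_not.1 ((AlgPoints.pt_mem_basicOpen_iff Q hQ f).symm.trans
      (mem_basicOpen_iff_notMem_primeIdealOf hU ⟨Q.pt, hQ⟩ f))
  have hscal : ∀ (Q : ComplexPoints X) (hQ : Q.pt ∈ U) (r : ℂ),
      Q.eval U hQ (SchemeOver.scalarRingHom X U r) = r := fun Q hQ r ↦ by
    rw [AlgPoints.eval_scalarRingHom]; rfl
  have hkerI : ∀ (Q : ComplexPoints X) (hQ : Q.pt ∈ U), Q.pt ∈ Z →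
      I ≤ RingHom.ker (Q.evalRingHom U hQ) := by
    intro Q hQ hQZ f hf
    rw [RingHom.mem_ker, AlgPoints.evalRingHom_apply, hevalmem]
    have hq' : hU.primeIdealOf ⟨Q.pt, hQ⟩ ∈ Z' := by
      show hU.fromSpec.base (hU.primeIdealOf ⟨Q.pt, hQ⟩) ∈ Z
      rw [hU.fromSpec_primeIdealOf ⟨Q.pt, hQ⟩]
      exact hQZ
    exact (hZI _).1 hq' hf
  have hkermax : ∀ (Q : ComplexPoints X) (hQ : Q.pt ∈ U), (RingHom.ker (Q.evalRingHom U hQ)).IsMaximal :=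
    fun Q hQ ↦ RingHom.ker_isMaximal_of_surjective _ fun r ↦ ⟨SchemeOver.scalarRingHom X U r, by
      rw [AlgPoints.evalRingHom_apply, hscal]⟩
  -- the map `Q ↦ 𝔪_Q / I` into the finite set of maximal ideals of `B` above `(yᵢ - cᵢ)`
  set F : Set (ComplexPoints X) := {P | ∃ h : P.pt ∈ U, P.pt ∈ Z ∧ ∀ i, P.eval U h (a i) = c i}
  set μ : ComplexPoints X → Ideal (Γ(X.left, U) ⧸ I) := fun Q ↦
    if hQ : Q.pt ∈ U then (RingHom.ker (Q.evalRingHom U hQ)).map (Ideal.Quotient.mk I) else ⊤ with hμ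
  have hμF : ∀ Q ∈ F, μ Q ∈ {𝔪 : Ideal (Γ(X.left, U) ⧸ I) | 𝔪.IsMaximal ∧
      ∀ i, y i - algebraMap ℂ (Γ(X.left, U) ⧸ I) (c i) ∈ 𝔪} := by
    rintro Q ⟨hQ, hQZ, hQc⟩
    have hμQ : μ Q = (RingHom.ker (Q.evalRingHom U hQ)).map (Ideal.Quotient.mk I) := by
      rw [hμ]; exact dif_pos hQ
    haveI := hkermax Q hQ
    have hcomap : ((RingHom.ker (Q.evalRingHom U hQ)).map (Ideal.Quotient.mk I)).comap
        (Ideal.Quotient.mk I) = RingHom.ker (Q.evalRingHom U hQ) := by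
      rw [Ideal.comap_map_of_surjective _ Ideal.Quotient.mk_surjective, ← RingHom.ker_eq_comap_bot,
        Ideal.mk_ker, sup_eq_left]
      exact hkerI Q hQ hQZ
    refine ⟨?_, fun i ↦ ?_⟩
    · rw [hμQ]
      refine (Ideal.map_eq_top_or_isMaximal_of_surjective _ Ideal.Quotient.mk_surjective
        (hkermax Q hQ)).resolve_left fun htop ↦ ?_
      have : RingHom.ker (Q.evalRingHom U hQ) = ⊤ := by rw [← hcomap, htop, Ideal.comap_top]
      exact (hkermax Q hQ).ne_top this
    · rw [hμQ, ← ha i, show algebraMap ℂ (Γ(X.left, U) ⧸ I) (c i) =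
          Ideal.Quotient.mk I (SchemeOver.scalarRingHom X U (c i)) from rfl, ← map_sub]
      refine Ideal.mem_map_of_mem _ ?_
      rw [RingHom.mem_ker, map_sub, AlgPoints.evalRingHom_apply, AlgPoints.evalRingHom_apply, hQc i,
        hscal, sub_self]
  have hμinj : InjOn μ F := by
    rintro P ⟨hP, hPZ, -⟩ Q ⟨hQ, hQZ, -⟩ hPQ
    have hμP : μ P = (RingHom.ker (P.evalRingHom U hP)).map (Ideal.Quotient.mk I) := by
      rw [hμ]; exact dif_pos hP
    have hμQ : μ Q = (RingHom.ker (Q.evalRingHom U hQ)).map (Ideal.Quotient.mk I) := by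
      rw [hμ]; exact dif_pos hQ
    have hker : RingHom.ker (P.evalRingHom U hP) = RingHom.ker (Q.evalRingHom U hQ) := by
      have hcP : ((RingHom.ker (P.evalRingHom U hP)).map (Ideal.Quotient.mk I)).comap
          (Ideal.Quotient.mk I) = RingHom.ker (P.evalRingHom U hP) := by
        rw [Ideal.comap_map_of_surjective _ Ideal.Quotient.mk_surjective, ← RingHom.ker_eq_comap_bot,
          Ideal.mk_ker, sup_eq_left]
        exact hkerI P hP hPZ
      have hcQ : ((RingHom.ker (Q.evalRingHom U hQ)).map (Ideal.Quotient.mk I)).comap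
          (Ideal.Quotient.mk I) = RingHom.ker (Q.evalRingHom U hQ) := by
        rw [Ideal.comap_map_of_surjective _ Ideal.Quotient.mk_surjective, ← RingHom.ker_eq_comap_bot,
          Ideal.mk_ker, sup_eq_left]
        exact hkerI Q hQ hQZ
      rw [← hcP, ← hcQ, ← hμP, ← hμQ, hPQ]
    refine AlgPoints.ext_of_forall_eval_eq hU hP hQ fun f ↦ ?_
    have hf : f - SchemeOver.scalarRingHom X U (P.eval U hP f) ∈ RingHom.ker (Q.evalRingHom U hQ) := by
      rw [← hker, RingHom.mem_ker, map_sub, AlgPoints.evalRingHom_apply, AlgPoints.evalRingHom_apply,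
        hscal, sub_self]
    rw [RingHom.mem_ker, map_sub, AlgPoints.evalRingHom_apply, AlgPoints.evalRingHom_apply, hscal,
      sub_eq_zero] at hf
    exact hf.symm
  exact Set.Finite.of_finite_image ((hy c).subset (Set.mapsTo_iff_image_subset.1 hμF)) hμinj

/-! ### The converse GAGA dimension comparison -/

/-- **GAGA dimension comparison, converse direction** (Serre 1956, §6 Prop. 3 Cor. 2–3, p. 11:
«Les anneaux `𝒪_x` et `ℋ_x` ont même dimension»; «Si `X` est une variété algébrique irréductible de
dimension `r`, l'espace analytique `X^h` est de dimension analytique `r` en chacun de ses points» —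
here the inequality `dim_analytique ≤ dim_algébrique`, i.e. analytic codimension `≥` algebraic
codimension, the converse of the tree's `gaga_le_coheight_of_regularLocus_codim_holds`). For `X`
smooth projective of dimension `n` over `ℂ`, an analytification `φ : M → X(ℂ)` (holomorphic atlas on
`M`, model `E ≅ ℂⁿ`) and a Zariski-closed `Z ⊆ X` all of whose scheme points have codimension
`≥ p`, every regular point of the analytic set `φ⁻¹(Z(ℂ))` has complex codimension `≥ p`. Proof:
Noether coordinates `a₁, …, a_s` (`s ≤ n − p`) on an affine chart have finite fibres on
`Z(ℂ)` (`exists_affineOpen_finite_fibers`), and a holomorphic map with finite fibres on a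
submanifold piece of codimension `q` forces `n ≤ q + s` (`finrank_le_codim_add_of_finite_fibers`).
[cite: SerreGAGA1956, §6 Prop. 3 Cor. 2–3 (p. 11)] -/
theorem le_regularLocus_codim_of_le_coheight ⦃n : ℕ⦄ ⦃X : SchemeOver ℂ⦄ (hX : IsSmoothProjective n X)
    {E : Type} [NormedAddCommGroup E] [NormedSpace ℂ E] [FiniteDimensional ℂ E]
    {M : Type} [TopologicalSpace M] [ChartedSpace E M] [IsManifold 𝓘(ℂ, E) ω M]
    {φ : M → ComplexPoints X} (hφ : IsAnalytification E X n φ) (p : ℕ) (Z : Set X.left)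
    (hZ : IsClosed Z) (hcoh : ∀ z ∈ Z, (p : ℕ∞) ≤ Order.coheight z) :
    ∀ x ∈ Literature.Geometry.Kaehler.regularLocus 𝓘(ℂ, E) (φ ⁻¹' {P | P.pt ∈ Z}), ∀ q,
      Literature.Geometry.Kaehler.IsRegularPointOfCodim 𝓘(ℂ, E) (φ ⁻¹' {P | P.pt ∈ Z}) q x → p ≤ q := by
  intro x hx q hreg
  haveI : IsManifold 𝓘(ℂ, E) 1 M := IsManifold.of_le (n := ω) le_top
  set S : Set M := φ ⁻¹' {P | P.pt ∈ Z} with hS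
  have hxZ : (φ x).pt ∈ Z := hx.1
  obtain ⟨U, hzU, s, hsp, a, hfin⟩ := exists_affineOpen_finite_fibers hX hZ hcoh hxZ
  set W : Set M := φ ⁻¹' {P | P.pt ∈ U} with hW
  have hWo : IsOpen W := hφ.isOpen_preimage U
  set Θ : M → (Fin s → ℂ) := fun m i ↦ evalOrZero U (a i) (φ m) with hΘ
  have hΘd : MDifferentiableOn 𝓘(ℂ, E) 𝓘(ℂ, Fin s → ℂ) Θ W :=
    Literature.Geometry.Kaehler.mdifferentiableOn_pi_space.2 fun i ↦
      IsAnalytification.mdifferentiableOn_evalOrZero_opens_holds hφ U (a i)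
  have hfin' : ∀ c, (S ∩ W ∩ Θ ⁻¹' {c}).Finite := by
    intro c
    refine Set.Finite.of_finite_image ((hfin c).subset ?_) (hφ.isHomeomorph.injective.injOn)
    rintro _ ⟨m, ⟨⟨hmS, hmW⟩, hmc⟩, rfl⟩
    refine ⟨hmW, hmS, fun i ↦ ?_⟩
    have h := congrFun hmc i
    simp only [hΘ] at h
    rw [← evalOrZero_of_mem (a i) hmW]
    exact h
  have hE : Module.finrank ℂ E = n := hφ.finrank_eq
  have := finrank_le_codim_add_of_finite_fibers hWo hΘd hfin' hx.1 hzU hreg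
  omega

end Literature.AlgebraicGeometry.HodgeTheory
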